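import Literature.Computability.Complexity.SumcheckPolyArith
import Mathlib.Data.ZMod.Basic
import Mathlib.Algebra.Polynomial.Div
import Mathlib.Data.List.DropRight
import HarnessLib

/-!
# Dense polynomial arithmetic modulo `M` on coefficient lists (for LLL 1982, §3)

Support file for the discharge of the named fact
`Literature.Computability.Complexity.lll_monicIrreducible_mem_P` (irreducibility of monic integer
polynomials is decidable in `P`; Lenstra–Lenstra–Lovász 1982, §3). The algorithm of LLL82 §3
(Berlekamp modulo `p`, Hensel modulo `p^k`) computes with polynomials over `ℤ/Mℤ`; at the machine
level these are coefficient lists `List ℤ` (low degree first, entries in `[0, M)`), read in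
`(ℤ/M)[X]` by `toZMod M a = (ofCoeffs a) mod M` (`SumcheckMA.ofCoeffs`, the dense integer
polynomial toolkit of `SumcheckPolyArith.lean`, supplies `padd`, `pscale`, `pshift`, `pmul` with
their `ℤ[X]` semantics and `CodeFP` facts). This file adds the operations the factoring
algorithm needs and proves their semantics; their polynomial-time realisation on codes is a
separate file.

* `toZMod M a` and its values on `[]`, `padd`, `pscale`, `pshift`, `pmul`, `psub`;
* `pmod M a` — coefficientwise reduction into `[0, M)` (`toZMod_pmod`, `Reduced M (pmod M a)`);
* `trim a` — remove trailing zeros (`ofCoeffs_trim`, `getLast_trim_ne_zero`); for a reduced and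
  trimmed list ("normal form", `pnorm M a = trim (pmod M a)`) the list IS the polynomial:
  `toZMod M a = 0 ↔ a = []`, `natDegree (toZMod M a) = |a| - 1`, leading coefficient `= last a`
  (`natDegree_toZMod_of_normal`, `leadingCoeff_toZMod_of_normal`, `toZMod_injective_of_normal`);
* `divStep`, `pdivmod M a b` — long division by a MONIC normal `b` with all arithmetic modulo `M`,
  as a fold over a unary budget (`|a| + 1 - |b|` steps), and its specification
  `toZMod_pdivmod` (`ā = q̄ b̄ + r̄`), `length_pdivmod_snd_lt` (`|r| < |b|`), whence
  `toZMod_pdivmod_fst/snd` (`q̄ = ā /ₘ b̄`, `r̄ = ā %ₘ b̄`) and the reducedness of `q`, `r`.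

## References

* D. E. Knuth, *The Art of Computer Programming*, Vol. 2, 3rd ed., 1998, §4.6.1, Algorithm D
  (division of polynomials over a commutative ring by a monic polynomial). [KnuthTAOCP2]
* A. K. Lenstra, H. W. Lenstra Jr., L. Lovász, *Factoring polynomials with rational coefficients*,
  Math. Ann. 261 (1982), §3 (arithmetic modulo `p` and `p^k` in steps (3.1)–(3.2)). [LenstraLenstraLovasz1982]
-/

noncomputable section

namespace Literature.Computability.Complexity

open Polynomial SumcheckMA

namespace LLLFactoring

/-! ### The semantic map to `(ℤ/M)[X]` -/

/-- The polynomial over `ℤ/Mℤ` read off a coefficient list: `(Σ aⱼ Xʲ) mod M`.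
[cite: KnuthTAOCP2, §4.6.1] -/
def toZMod (M : ℕ) (a : List ℤ) : (ZMod M)[X] := (ofCoeffs a).map (Int.castRingHom (ZMod M))

variable {M : ℕ}

/-- Coefficients of `toZMod`. [folklore] -/
theorem coeff_toZMod (a : List ℤ) (j : ℕ) : (toZMod M a).coeff j = ((a.getD j 0 : ℤ) : ZMod M) := by
  rw [toZMod, coeff_map, coeff_ofCoeffs]; rfl

/-- `toZMod [] = 0`. [folklore] -/
@[simp] theorem toZMod_nil : toZMod M [] = 0 := by simp [toZMod, ofCoeffs]

/-- `toZMod (c :: a) = c + X · toZMod a`. [folklore] -/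
theorem toZMod_cons (c : ℤ) (a : List ℤ) : toZMod M (c :: a) = C ((c : ℤ) : ZMod M) + X * toZMod M a := by
  simp [toZMod, ofCoeffs, Polynomial.map_mul]

/-- `toZMod` of a sum. [folklore] -/
theorem toZMod_padd (a b : List ℤ) : toZMod M (padd a b) = toZMod M a + toZMod M b := by
  rw [toZMod, ofCoeffs_padd, Polynomial.map_add]; rfl

/-- `toZMod` of a scaling. [folklore] -/
theorem toZMod_pscale (c : ℤ) (b : List ℤ) : toZMod M (pscale c b) = C ((c : ℤ) : ZMod M) * toZMod M b := by
  rw [toZMod, ofCoeffs_pscale, Polynomial.map_mul, Polynomial.map_C]; rfl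

/-- `toZMod` of a shift. [folklore] -/
theorem toZMod_pshift (i : ℕ) (b : List ℤ) : toZMod M (pshift i b) = X ^ i * toZMod M b := by
  rw [toZMod, ofCoeffs_pshift, Polynomial.map_mul, Polynomial.map_pow, Polynomial.map_X]; rfl

/-- `toZMod` of a product. [folklore] -/
theorem toZMod_pmul (a b : List ℤ) : toZMod M (pmul a b) = toZMod M a * toZMod M b := by
  rw [toZMod, ofCoeffs_pmul, Polynomial.map_mul]; rfl

/-- Subtraction of coefficient lists: `a ⊖ b = a ⊕ (-1)·b`. [cite: KnuthTAOCP2, §4.6.1] -/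
def psub (a b : List ℤ) : List ℤ := padd a (pscale (-1) b)

/-- `toZMod` of a difference. [folklore] -/
theorem toZMod_psub (a b : List ℤ) : toZMod M (psub a b) = toZMod M a - toZMod M b := by
  rw [psub, toZMod_padd, toZMod_pscale]; simp [sub_eq_add_neg]

/-- Length of a difference. [folklore] -/
theorem length_psub (a b : List ℤ) : (psub a b).length = max a.length b.length := by
  rw [psub, padd, CodeFP.length_zipWithPad, pscale, List.length_map]

/-! ### Reduction of the coefficients into `[0, M)` -/

/-- All entries lie in `[0, M)`. [folklore] -/
def Reduced (M : ℕ) (a : List ℤ) : Prop := ∀ c ∈ a, 0 ≤ c ∧ c < M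

/-- Coefficientwise reduction modulo `M` into `[0, M)`. [cite: KnuthTAOCP2, §4.6.1] -/
def pmod (M : ℕ) (a : List ℤ) : List ℤ := a.map fun c => c % (M : ℤ)

/-- `pmod` preserves the length. [folklore] -/
@[simp] theorem length_pmod (a : List ℤ) : (pmod M a).length = a.length := List.length_map _

/-- Reduction does not change the polynomial modulo `M`. [folklore] -/
theorem toZMod_pmod (a : List ℤ) : toZMod M (pmod M a) = toZMod M a := by
  ext j
  rw [coeff_toZMod, coeff_toZMod, pmod, List.getD_eq_getElem?_getD, List.getElem?_map, List.getD_eq_getElem?_getD]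
  cases a[j]? with
  | none => rfl
  | some c =>
    simp only [Option.map_some, Option.getD_some]
    exact (ZMod.intCast_mod c M)

/-- The reduced list is reduced (`M ≥ 1`). [folklore] -/
theorem reduced_pmod (hM : 0 < M) (a : List ℤ) : Reduced M (pmod M a) := by
  intro c hc
  obtain ⟨x, -, rfl⟩ := List.mem_map.1 hc
  have hM' : (0 : ℤ) < M := by exact_mod_cast hM
  exact ⟨Int.emod_nonneg _ hM'.ne', Int.emod_lt_of_pos _ hM'⟩

/-- Sublists of reduced lists are reduced. [folklore] -/
theorem Reduced.of_subset {a b : List ℤ} (h : Reduced M a) (hb : b ⊆ a) : Reduced M b :=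
  fun c hc => h c (hb hc)

/-- A reduced entry is zero modulo `M` iff it is zero. [folklore] -/
theorem cast_eq_zero_iff_of_reduced {c : ℤ} (h0 : 0 ≤ c) (hM : c < M) : ((c : ℤ) : ZMod M) = 0 ↔ c = 0 := by
  rw [ZMod.intCast_zmod_eq_zero_iff_dvd]
  constructor
  · intro hd
    rcases eq_or_lt_of_le h0 with h | h
    · exact h.symm
    · exact absurd (Int.le_of_dvd h hd) (not_le.2 hM)
  · rintro rfl; exact dvd_zero _

/-! ### Trailing zeros -/

/-- Remove the trailing zeros of a coefficient list. [cite: KnuthTAOCP2, §4.6.1] -/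
def trim (a : List ℤ) : List ℤ := a.rdropWhile fun c => decide (c = 0)

/-- `trim [] = []`. [folklore] -/
@[simp] theorem trim_nil : trim [] = [] := by simp [trim]

/-- `trim` on a snoc. [folklore] -/
theorem trim_concat (a : List ℤ) (c : ℤ) : trim (a ++ [c]) = if c = 0 then trim a else a ++ [c] := by
  rw [trim, List.rdropWhile_concat]
  by_cases h : c = 0 <;> simp [h, trim]

/-- Appending a zero does not change the polynomial. [folklore] -/
theorem ofCoeffs_concat_zero (a : List ℤ) : ofCoeffs (a ++ [0]) = ofCoeffs a := by
  ext j
  rw [coeff_ofCoeffs, coeff_ofCoeffs]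
  rcases lt_trichotomy j a.length with h | h | h
  · rw [List.getD_eq_getElem _ _ (by simp; omega), List.getElem_append_left h, List.getD_eq_getElem _ _ h]
  · subst h
    rw [List.getD_eq_getElem _ _ (by simp), List.getElem_append_right (le_refl _)]
    simp
  · rw [List.getD_eq_default _ _ (by simp; omega), List.getD_eq_default _ _ (by omega)]

/-- `trim` does not change the polynomial. [folklore] -/
theorem ofCoeffs_trim (a : List ℤ) : ofCoeffs (trim a) = ofCoeffs a := by
  induction a using List.reverseRecOn with
  | nil => simp
  | append_singleton a c ih =>
    rw [trim_concat]
    split_ifs with h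
    · rw [ih, h, ofCoeffs_concat_zero]
    · rfl

/-- `trim` does not change the polynomial modulo `M`. [folklore] -/
theorem toZMod_trim (a : List ℤ) : toZMod M (trim a) = toZMod M a := by
  rw [toZMod, toZMod, ofCoeffs_trim]

/-- A trimmed list is empty or ends in a nonzero entry. [folklore] -/
theorem trim_eq_nil_or_getLast (a : List ℤ) : trim a = [] ∨ ∃ (h : trim a ≠ []), (trim a).getLast h ≠ 0 := by
  induction a using List.reverseRecOn with
  | nil => simp
  | append_singleton a c ih =>
    rw [trim_concat]
    split_ifs with h
    · exact ih
    · exact Or.inr ⟨by simp, by simpa using h⟩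

/-- `trim` is a prefix: it only shortens. [folklore] -/
theorem trim_prefix (a : List ℤ) : trim a <+: a := List.rdropWhile_prefix _ _

/-- `trim` only shortens. [folklore] -/
theorem length_trim_le (a : List ℤ) : (trim a).length ≤ a.length := (trim_prefix a).length_le

/-- `trim` keeps sub-membership. [folklore] -/
theorem trim_subset (a : List ℤ) : trim a ⊆ a := (trim_prefix a).subset

/-- `trim` is idempotent. [folklore] -/
theorem trim_trim (a : List ℤ) : trim (trim a) = trim a := by
  rcases trim_eq_nil_or_getLast a with h | ⟨hne, hlast⟩
  · rw [h, trim_nil]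
  · conv_lhs => rw [← List.dropLast_append_getLast hne, trim_concat, if_neg hlast]
    exact List.dropLast_append_getLast hne

/-! ### Normal forms: reduced and trimmed lists are their polynomials -/

/-- The normal form modulo `M`: reduce, then trim. [cite: KnuthTAOCP2, §4.6.1] -/
def pnorm (M : ℕ) (a : List ℤ) : List ℤ := trim (pmod M a)

/-- `Normal M a`: reduced into `[0, M)` and without trailing zeros. [folklore] -/
def Normal (M : ℕ) (a : List ℤ) : Prop := Reduced M a ∧ trim a = a

/-- The normal form has the same polynomial. [folklore] -/
theorem toZMod_pnorm (a : List ℤ) : toZMod M (pnorm M a) = toZMod M a := by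
  rw [pnorm, toZMod_trim, toZMod_pmod]

/-- The normal form is normal (`M ≥ 1`). [folklore] -/
theorem normal_pnorm (hM : 0 < M) (a : List ℤ) : Normal M (pnorm M a) :=
  ⟨(reduced_pmod hM a).of_subset (trim_subset _), trim_trim _⟩

/-- The normal form is not longer. [folklore] -/
theorem length_pnorm_le (a : List ℤ) : (pnorm M a).length ≤ a.length :=
  (length_trim_le _).trans (length_pmod a).le

/-- For a reduced list, the polynomial modulo `M` vanishes iff all entries vanish iff the trimmed
list is empty. [folklore] -/
theorem toZMod_eq_zero_iff_trim_eq_nil {a : List ℤ} (ha : Reduced M a) : toZMod M a = 0 ↔ trim a = [] := by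
  induction a using List.reverseRecOn with
  | nil => simp
  | append_singleton a c ih =>
    have hc := ha c (by simp)
    have ha' : Reduced M a := ha.of_subset (by simp)
    rw [trim_concat]
    have key : toZMod M (a ++ [c]) = toZMod M a + C ((c : ℤ) : ZMod M) * X ^ a.length := by
      ext j
      rw [coeff_toZMod, coeff_add, coeff_toZMod, coeff_C_mul, coeff_X_pow]
      rcases lt_trichotomy j a.length with h | h | h
      · rw [List.getD_eq_getElem _ _ (by simp; omega), List.getElem_append_left h, List.getD_eq_getElem _ _ h,
          if_neg h.ne, mul_zero, add_zero]
      · subst h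
        rw [List.getD_eq_getElem _ _ (by simp), List.getElem_append_right (le_refl _),
          List.getD_eq_default _ _ (le_refl _), if_pos rfl, mul_one]
        simp
      · rw [List.getD_eq_default _ _ (by simp; omega), List.getD_eq_default _ _ (by omega), if_neg h.ne',
          mul_zero, add_zero]
    split_ifs with h0
    · rw [key, h0, Int.cast_zero, map_zero, zero_mul, add_zero, ih ha']
    · simp only [List.append_eq_nil_iff, List.cons_ne_self, and_false, iff_false]
      intro hz
      have := congrArg (fun p => p.coeff a.length) hz
      simp only [key, coeff_add, coeff_toZMod, coeff_C_mul, coeff_X_pow, coeff_zero,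
        List.getD_eq_default _ _ (le_refl a.length), Int.cast_zero, zero_add, if_true, mul_one] at this
      exact h0 ((cast_eq_zero_iff_of_reduced hc.1 hc.2).1 this)

/-- A normal list represents `0` iff it is empty. [folklore] -/
theorem Normal.toZMod_eq_zero_iff {a : List ℤ} (ha : Normal M a) : toZMod M a = 0 ↔ a = [] := by
  rw [toZMod_eq_zero_iff_trim_eq_nil ha.1, ha.2]

/-- The degree of the polynomial of a nonempty normal list is `|a| - 1`, and its leading
coefficient is the (nonzero) last entry. [folklore] -/
theorem Normal.natDegree_toZMod {a : List ℤ} (ha : Normal M a) (hne : a ≠ []) :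
    (toZMod M a).natDegree = a.length - 1 ∧ (toZMod M a).leadingCoeff = ((a.getLast hne : ℤ) : ZMod M) := by
  have hlast : a.getLast hne ≠ 0 := by
    rcases trim_eq_nil_or_getLast a with h | ⟨h, h'⟩
    · exact absurd (ha.2 ▸ h) hne
    · simp only [ha.2] at h'; exact h'
  have hc := ha.1 _ (List.getLast_mem hne)
  have hlead : (toZMod M a).coeff (a.length - 1) = ((a.getLast hne : ℤ) : ZMod M) := by
    rw [coeff_toZMod, List.getD_eq_getElem _ _ (by have := List.length_pos_of_ne_nil hne; omega),
      List.getLast_eq_getElem]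
  have hne0 : (toZMod M a).coeff (a.length - 1) ≠ 0 := by
    rw [hlead]; exact fun h => hlast ((cast_eq_zero_iff_of_reduced hc.1 hc.2).1 h)
  have hdeg : (toZMod M a).natDegree = a.length - 1 := by
    refine le_antisymm ?_ (le_natDegree_of_ne_zero hne0)
    rw [natDegree_le_iff_coeff_eq_zero]
    intro N hN
    rw [coeff_toZMod, List.getD_eq_default _ _ (by omega), Int.cast_zero]
  exact ⟨hdeg, by rw [leadingCoeff, hdeg, hlead]⟩

/-- A normal list whose last entry is `1` represents a monic polynomial of degree `|a| - 1`. [folklore] -/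
theorem Normal.monic_toZMod {a : List ℤ} (ha : Normal M a) (hne : a ≠ []) (h1 : a.getLast hne = 1) :
    (toZMod M a).Monic ∧ (toZMod M a).natDegree = a.length - 1 := by
  obtain ⟨hdeg, hlead⟩ := ha.natDegree_toZMod hne
  exact ⟨by rw [Monic, hlead, h1]; simp, hdeg⟩

/-- The degree of the polynomial of any list is below its length. [folklore] -/
theorem degree_toZMod_lt (a : List ℤ) : (toZMod M a).degree < a.length := by
  refine (degree_lt_iff_coeff_zero _ _).2 fun N hN => ?_
  rw [coeff_toZMod, List.getD_eq_default _ _ hN, Int.cast_zero]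

/-! ### Long division by a monic polynomial modulo `M` -/

/-- One step of the long division of `r` by the monic `b` modulo `M` on the state `(q, r)`:
while `|r| ≥ |b|`, subtract `c·X^{|r|-|b|}·b` with `c` the top entry of `r`, reduce modulo `M`,
drop the (now zero) top entry and push `c` on the quotient. [cite: KnuthTAOCP2, §4.6.1, Algorithm D] -/
def divStep (M : ℕ) (b : List ℤ) (st : List ℤ × List ℤ) : List ℤ × List ℤ :=
  if st.2.length < b.length then st else
    (st.2.getLast?.getD 0 :: st.1,
      (pmod M (psub st.2 (pshift (st.2.length - b.length) (pscale (st.2.getLast?.getD 0) b)))).dropLast)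

/-- **Division with remainder by a monic polynomial, modulo `M`**: `|a| + 1 - |b|` division steps
from `([], a mod M)`; the result `(q, r)` has `ā = q̄ b̄ + r̄`, `|r| < |b|` (`toZMod_pdivmod`,
`length_pdivmod_snd_lt`). [cite: KnuthTAOCP2, §4.6.1, Algorithm D] -/
def pdivmod (M : ℕ) (a b : List ℤ) : List ℤ × List ℤ :=
  (List.replicate (a.length + 1 - b.length) ()).foldl (fun st _ => divStep M b st) ([], pmod M a)

/-- The invariant of the division loop: `ā = q̄ · X^{|r|+1-|b|} · b̄ + r̄`, everything reduced.
[cite: KnuthTAOCP2, §4.6.1, Algorithm D] -/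
def DivInv (M : ℕ) (a b : List ℤ) (st : List ℤ × List ℤ) : Prop :=
  toZMod M a = toZMod M st.1 * X ^ (st.2.length + 1 - b.length) * toZMod M b + toZMod M st.2 ∧
    Reduced M st.1 ∧ Reduced M st.2

/-- The last entry read through `getLast?`. [folklore] -/
theorem getLast?_getD_eq_getLast {r : List ℤ} (hr : r ≠ []) : r.getLast?.getD 0 = r.getLast hr := by
  rw [List.getLast?_eq_some_getLast hr, Option.getD_some]

/-- The top coefficient of the polynomial of a nonempty list is its last entry. [folklore] -/
theorem coeff_toZMod_length_sub_one {r : List ℤ} (hr : r ≠ []) :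
    (toZMod M r).coeff (r.length - 1) = ((r.getLast hr : ℤ) : ZMod M) := by
  rw [coeff_toZMod, List.getD_eq_getElem _ _ (by have := List.length_pos_of_ne_nil hr; omega),
    List.getLast_eq_getElem]

/-- Dropping a last entry that vanishes modulo `M` does not change the polynomial. [folklore] -/
theorem toZMod_dropLast_of_cast_getLast_eq_zero {t : List ℤ} (ht : t ≠ [])
    (h0 : ((t.getLast ht : ℤ) : ZMod M) = 0) : toZMod M t.dropLast = toZMod M t := by
  ext j
  rw [coeff_toZMod, coeff_toZMod]
  have hlen : t.dropLast.length = t.length - 1 := List.length_dropLast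
  have hpos := List.length_pos_of_ne_nil ht
  rcases lt_trichotomy j (t.length - 1) with h | h | h
  · rw [List.getD_eq_getElem _ _ (by omega), List.getD_eq_getElem _ _ (by omega), List.getElem_dropLast]
  · subst h
    rw [List.getD_eq_default _ _ (by omega), List.getD_eq_getElem _ _ (by omega), ← List.getLast_eq_getElem ht,
      Int.cast_zero, h0]
  · rw [List.getD_eq_default _ _ (by omega), List.getD_eq_default _ _ (by omega)]

/-- **One division step preserves the invariant and shortens the remainder by one** (when
`|r| ≥ |b|`; `b̄` monic of degree `|b| - 1`, `M ≥ 1`). [cite: KnuthTAOCP2, §4.6.1, Algorithm D] -/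
theorem divStep_spec (hM : 0 < M) {a b : List ℤ} (hb0 : b ≠ []) (hbm : (toZMod M b).Monic)
    (hbd : (toZMod M b).natDegree = b.length - 1) {st : List ℤ × List ℤ} (hst : DivInv M a b st)
    (hlen : b.length ≤ st.2.length) :
    DivInv M a b (divStep M b st) ∧ (divStep M b st).2.length = st.2.length - 1 ∧
      (divStep M b st).1.length = st.1.length + 1 := by
  obtain ⟨q, r⟩ := st
  obtain ⟨hinv, hq, hr⟩ := hst
  dsimp only at hinv hq hr hlen ⊢
  have hbpos : 0 < b.length := List.length_pos_of_ne_nil hb0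
  have hr0 : r ≠ [] := by rintro rfl; simp only [List.length_nil] at hlen; omega
  rw [divStep, if_neg (not_lt.2 hlen)]
  set c := r.getLast?.getD 0 with hc
  have hcl : c = r.getLast hr0 := getLast?_getD_eq_getLast hr0
  set s := r.length - b.length with hs
  set t := psub r (pshift s (pscale c b)) with ht
  have htlen : t.length = r.length := by
    rw [ht, length_psub, length_pshift_pscale]; omega
  have ht0 : t ≠ [] := by rw [← List.length_pos_iff_ne_nil, htlen]; exact List.length_pos_of_ne_nil hr0
  have htZ : toZMod M t = toZMod M r - X ^ s * (C ((c : ℤ) : ZMod M) * toZMod M b) := by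
    rw [ht, toZMod_psub, toZMod_pshift, toZMod_pscale]
  -- the top coefficient of `t` vanishes
  have htop : (toZMod M t).coeff (r.length - 1) = 0 := by
    rw [htZ, coeff_sub, coeff_toZMod_length_sub_one hr0, ← hcl, coeff_X_pow_mul', if_pos (by omega),
      coeff_C_mul, show r.length - 1 - s = b.length - 1 by omega, ← hbd, ← leadingCoeff, hbm.leadingCoeff,
      mul_one, sub_self]
  set t' := pmod M t with ht'
  have ht'len : t'.length = r.length := by rw [ht', length_pmod, htlen]
  have ht'0 : t' ≠ [] := by rw [← List.length_pos_iff_ne_nil, ht'len]; exact List.length_pos_of_ne_nil hr0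
  have ht'red : Reduced M t' := reduced_pmod hM t
  have hlast0 : ((t'.getLast ht'0 : ℤ) : ZMod M) = 0 := by
    rw [← coeff_toZMod_length_sub_one ht'0, ht'len, ht', toZMod_pmod, htop]
  refine ⟨⟨?_, ?_, ?_⟩, ?_, ?_⟩
  · -- the invariant
    dsimp only
    rw [toZMod_dropLast_of_cast_getLast_eq_zero ht'0 hlast0, List.length_dropLast, ht'len, ht', toZMod_pmod,
      htZ, toZMod_cons, hinv]
    have hexp : r.length + 1 - b.length = s + 1 := by omega
    have hexp' : r.length - 1 + 1 - b.length = s := by omega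
    rw [hexp, hexp']
    ring
  · -- `q` stays reduced: `c` is an entry of `r`
    intro x hx
    rcases List.mem_cons.1 hx with rfl | hx
    · rw [hcl]; exact hr _ (List.getLast_mem hr0)
    · exact hq x hx
  · exact ht'red.of_subset (List.dropLast_subset t')
  · dsimp only; rw [List.length_dropLast, ht'len]
  · rfl

/-- Idle steps: once `|r| < |b|` nothing changes. [folklore] -/
theorem divStep_of_lt {b : List ℤ} {st : List ℤ × List ℤ} (h : st.2.length < b.length) : divStep M b st = st := by
  rw [divStep, if_pos h]

/-- The division run: after `j ≤ |a| + 1 - |b|` steps the invariant holds, `|r| = |a| - j` and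
`|q| = j` (for `|b| ≤ |a| + 1`). [cite: KnuthTAOCP2, §4.6.1, Algorithm D] -/
theorem divRun_spec (hM : 0 < M) {a b : List ℤ} (hb0 : b ≠ []) (hbm : (toZMod M b).Monic)
    (hbd : (toZMod M b).natDegree = b.length - 1) (hab : b.length ≤ a.length + 1) :
    ∀ j : ℕ, j ≤ a.length + 1 - b.length →
      DivInv M a b ((List.replicate j ()).foldl (fun st _ => divStep M b st) ([], pmod M a)) ∧
        ((List.replicate j ()).foldl (fun st _ => divStep M b st) ([], pmod M a)).2.length = a.length - j ∧
        ((List.replicate j ()).foldl (fun st _ => divStep M b st) ([], pmod M a)).1.length = j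
  | 0, _ => by
    refine ⟨⟨?_, fun _ h => by simp at h, reduced_pmod hM a⟩, by simp, rfl⟩
    simp [toZMod_pmod]
  | j + 1, hj => by
    obtain ⟨hinv, hlen, hqlen⟩ := divRun_spec hM hb0 hbm hbd hab j (by omega)
    rw [List.replicate_succ', List.foldl_append, List.foldl_cons, List.foldl_nil]
    have hstep := divStep_spec hM hb0 hbm hbd hinv (by rw [hlen]; omega)
    refine ⟨hstep.1, ?_, ?_⟩
    · rw [hstep.2.1, hlen]; omega
    · rw [hstep.2.2, hqlen]

/-- **Specification of `pdivmod`**: `ā = q̄ b̄ + r̄` with `q`, `r` reduced, `|r| < |b|`,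
`|r| ≤ |a|`, `|q| ≤ |a| + 1` (`b̄` monic of degree `|b| - 1`, `M ≥ 1`).
[cite: KnuthTAOCP2, §4.6.1, Algorithm D] -/
theorem pdivmod_spec (hM : 0 < M) {a b : List ℤ} (hb0 : b ≠ []) (hbm : (toZMod M b).Monic)
    (hbd : (toZMod M b).natDegree = b.length - 1) :
    toZMod M a = toZMod M (pdivmod M a b).1 * toZMod M b + toZMod M (pdivmod M a b).2 ∧
      Reduced M (pdivmod M a b).1 ∧ Reduced M (pdivmod M a b).2 ∧
      (pdivmod M a b).2.length < b.length ∧ (pdivmod M a b).2.length ≤ a.length ∧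
      (pdivmod M a b).1.length ≤ a.length + 1 := by
  have hbpos : 0 < b.length := List.length_pos_of_ne_nil hb0
  by_cases hab : b.length ≤ a.length + 1
  · obtain ⟨⟨hinv, hq, hr⟩, hlen, hqlen⟩ := divRun_spec hM hb0 hbm hbd hab (a.length + 1 - b.length) le_rfl
    rw [← pdivmod] at hinv hq hr hlen hqlen
    have hrlen : (pdivmod M a b).2.length = b.length - 1 := by rw [hlen]; omega
    refine ⟨?_, hq, hr, by omega, by omega, by omega⟩
    rw [hinv, hrlen, show b.length - 1 + 1 - b.length = 0 by omega, pow_zero, mul_one]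
  · -- no step at all: `|a| + 1 < |b|`
    have h0 : a.length + 1 - b.length = 0 := by omega
    have hres : pdivmod M a b = ([], pmod M a) := by rw [pdivmod, h0]; rfl
    rw [hres]
    refine ⟨by simp [toZMod_pmod], fun _ h => by simp at h, reduced_pmod hM a, ?_, by simp, by simp⟩
    simp only [length_pmod]; omega

/-- **`pdivmod` computes quotient and remainder**: `q̄ = ā /ₘ b̄` and `r̄ = ā %ₘ b̄`.
[cite: KnuthTAOCP2, §4.6.1, Algorithm D] -/
theorem toZMod_pdivmod (hM : 0 < M) {a b : List ℤ} (hb0 : b ≠ []) (hbm : (toZMod M b).Monic)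
    (hbd : (toZMod M b).natDegree = b.length - 1) :
    toZMod M (pdivmod M a b).1 = toZMod M a /ₘ toZMod M b ∧ toZMod M (pdivmod M a b).2 = toZMod M a %ₘ toZMod M b := by
  obtain ⟨hinv, -, -, hlt, -, -⟩ := pdivmod_spec hM (a := a) hb0 hbm hbd
  nontriviality (ZMod M)
  have hdeg : (toZMod M (pdivmod M a b).2).degree < (toZMod M b).degree := by
    refine (degree_toZMod_lt _).trans_le ?_
    rw [degree_eq_natDegree hbm.ne_zero, hbd]
    exact_mod_cast (by omega)
  have h := div_modByMonic_unique (f := toZMod M a) (toZMod M (pdivmod M a b).1) (toZMod M (pdivmod M a b).2) hbm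
    ⟨by rw [hinv]; ring, hdeg⟩
  exact ⟨h.1.symm, h.2.symm⟩

/-! ### Products and remainders in normal form -/

/-- Product modulo `M` in normal form. [cite: KnuthTAOCP2, §4.6.1] -/
def pmulM (M : ℕ) (a b : List ℤ) : List ℤ := pnorm M (pmul a b)

/-- `toZMod` of the normal product. [folklore] -/
theorem toZMod_pmulM (a b : List ℤ) : toZMod M (pmulM M a b) = toZMod M a * toZMod M b := by
  rw [pmulM, toZMod_pnorm, toZMod_pmul]

/-- The normal product is normal. [folklore] -/
theorem normal_pmulM (hM : 0 < M) (a b : List ℤ) : Normal M (pmulM M a b) := normal_pnorm hM _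

/-- The normal product is not longer than `|a| + |b|`. [folklore] -/
theorem length_pmulM_le (a b : List ℤ) : (pmulM M a b).length ≤ a.length + b.length :=
  (length_pnorm_le _).trans (length_pmul_le a b)

/-- Remainder modulo a monic polynomial, modulo `M`, in normal form. [cite: KnuthTAOCP2, §4.6.1] -/
def pmodM (M : ℕ) (a b : List ℤ) : List ℤ := pnorm M (pdivmod M a b).2

/-- `toZMod` of the normal remainder. [folklore] -/
theorem toZMod_pmodM (hM : 0 < M) {a b : List ℤ} (hb0 : b ≠ []) (hbm : (toZMod M b).Monic)
    (hbd : (toZMod M b).natDegree = b.length - 1) : toZMod M (pmodM M a b) = toZMod M a %ₘ toZMod M b := by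
  rw [pmodM, toZMod_pnorm, (toZMod_pdivmod hM hb0 hbm hbd).2]

/-- The normal remainder is normal. [folklore] -/
theorem normal_pmodM (hM : 0 < M) (a b : List ℤ) : Normal M (pmodM M a b) := normal_pnorm hM _

/-- The normal remainder is shorter than the divisor (and than `|a| + 1`). [folklore] -/
theorem length_pmodM_lt (hM : 0 < M) {a b : List ℤ} (hb0 : b ≠ []) (hbm : (toZMod M b).Monic)
    (hbd : (toZMod M b).natDegree = b.length - 1) : (pmodM M a b).length < b.length :=
  (length_pnorm_le _).trans_lt (pdivmod_spec hM (a := a) hb0 hbm hbd).2.2.2.1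

/-- The normal remainder is not longer than `a`. [folklore] -/
theorem length_pmodM_le (hM : 0 < M) {a b : List ℤ} (hb0 : b ≠ []) (hbm : (toZMod M b).Monic)
    (hbd : (toZMod M b).natDegree = b.length - 1) : (pmodM M a b).length ≤ a.length :=
  (length_pnorm_le _).trans (pdivmod_spec hM (a := a) hb0 hbm hbd).2.2.2.2.1

end LLLFactoring

end Literature.Computability.Complexity
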